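import Summits.AtomisticToContinuum.BoseEinsteinCondensation.Theses.BECStoquasticCensoring
import Literature.Probability.LatticeModels.GarbanSpencerVillainLongRangeOrder
import Literature.Probability.LatticeModels.VillainTorusEmbedding
import Literature.Probability.LatticeModels.VillainTorusTwoPoint
import Literature.Probability.LatticeModels.VillainCurrentDuality
import HarnessLib

/-!
# `HomogeneousVillainLRO` (route BECStoquasticCensoring, item stmt-AtomisticToContinuum-11478)

Equal-time block long-range order of the (3+1)-dimensional Villain current model on the space-time
torus `(ℤ/(M+1)ℤ)³ × ℤ/(T+1)ℤ` with direction-wise stiffnesses `K_i ≥ K₀`, uniformly in `M`, `T`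
and the anisotropy: `c (M+1)⁶ Z(0) ≤ ∑_{x,y} Z(δ_{(x,0)} − δ_{(y,0)})` — PROVED unconditionally
(`homogeneousVillainLRO_proof`).

Proof.  The inline `ℝ≥0∞` current sums are those of `VillainCurrentModel.ofCurried`
(`currentSum_ofCurried`), so the item is the constant-in-space case of the ENGINE
`villainCurrent_blockSum_lowerBound`, stated for an ARBITRARY bondwise stiffness field `κ_b ≥ K₀`
(which therefore also serves the inhomogeneous item `VillainCurrentLRO`).  By the worm
representation (`VillainCurrentModel.twoPoint_eq_ofReal_villainTwoPoint`, tree) `Z(ρ_{xy}) = G(x,y) Z(0)` with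
`G` the Villain spin two-point function on the torus multigraph; by Ginibre monotonicity
(`VillainCurrentModel.twoPoint_mono`, tree) `G` decreases when every stiffness is lowered to the constant `K₀`; the constant-stiffness function is the pure Villain expectation on
`U(1)^V` (`villainTwoPoint_eq_villainExpect`), which the Garban–Spencer theorem for the Villain
interaction (`villain_longRangeOrder`, proved in the tree without reflection positivity — hence no
parity restriction on `M + 1` and no dependence on `T`) bounds below by `1 − √(a log K₀/K₀) ≥ 1/2`
on all pairs of the cube `{-⌊M/16⌋,…,⌊M/16⌋}³` of the time-zero slice (ball paths of the cube
`{-⌊M/2⌋,…,⌊M/2⌋}³` pushed into the slice by `sliceEmbedding`; `ball_subset_box`); counting these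
pairs (and the diagonal for `M < 15`) gives `c = ½·16⁻⁶`.

## References

* C. Garban, T. Spencer, J. Math. Phys. 63 (2022) 093302 (Thm 1.3, Remarks 1, 10).
  [GarbanSpencer2022]
* J. Fröhlich, T. Spencer, Comm. Math. Phys. 83 (1982) 411–454, §2 (Villain model, duality).
  [FrohlichSpencerCMP1982]
* M. Wallin et al., Phys. Rev. B 49 (1994) 12115, §II (current representation). [WallinEtAl1994]
-/

noncomputable section

namespace Summit.AtomisticToContinuum.BoseEinsteinCondensation.Theorems

open MeasureTheory Finset Filter
open scoped BigOperators ENNReal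
open Literature.Probability.LatticeModels Literature.Probability.LatticeModels.JCurrent
  Literature.Probability.LatticeModels.PositiveCurrentModel

/-! ### Geometry of the good pairs in the time-zero slice -/

/-- Pairs of points of the small cube `{-m,…,m}³` satisfy Garban–Spencer's ball condition inside
the cube `{-n,…,n}³` as soon as `8m ≤ n`: every lattice point `z` with
`‖z − (x+y)/2‖₂ ≤ 2‖x − y‖₂` lies in `box 3 n`. [folklore] -/
theorem ball_subset_box {m n : ℕ} (hmn : 8 * m ≤ n) {x y : Site 3} (hx : x ∈ box 3 m) (hy : y ∈ box 3 m)
    (z : Site 3)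
    (hz : (∑ i, ((z i : ℝ) - ((x i : ℝ) + (y i : ℝ)) / 2) ^ 2) ≤ 4 * ∑ i, ((x i : ℝ) - (y i : ℝ)) ^ 2) :
    z ∈ box 3 n := by
  rw [mem_box] at hx hy ⊢
  have hm0 : (0 : ℝ) ≤ m := Nat.cast_nonneg m
  have hmn' : (8 : ℝ) * m ≤ n := by exact_mod_cast hmn
  -- `∑ (x_i − y_i)² ≤ 12 m²`
  have hxy : ∑ i, ((x i : ℝ) - (y i : ℝ)) ^ 2 ≤ 12 * (m : ℝ) ^ 2 := by
    have hterm : ∀ i, ((x i : ℝ) - (y i : ℝ)) ^ 2 ≤ 4 * (m : ℝ) ^ 2 := by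
      intro i
      obtain ⟨hx1, hx2⟩ := hx i
      obtain ⟨hy1, hy2⟩ := hy i
      have h1 : (-(m : ℝ)) ≤ x i := by exact_mod_cast hx1
      have h2 : (x i : ℝ) ≤ m := by exact_mod_cast hx2
      have h3 : (-(m : ℝ)) ≤ y i := by exact_mod_cast hy1
      have h4 : (y i : ℝ) ≤ m := by exact_mod_cast hy2
      nlinarith
    calc ∑ i, ((x i : ℝ) - (y i : ℝ)) ^ 2 ≤ ∑ _i : Fin 3, 4 * (m : ℝ) ^ 2 :=
          Finset.sum_le_sum fun i _ => hterm i
      _ = 12 * (m : ℝ) ^ 2 := by rw [Finset.sum_const, Finset.card_univ, Fintype.card_fin]; ring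
  intro i
  obtain ⟨hx1, hx2⟩ := hx i
  obtain ⟨hy1, hy2⟩ := hy i
  have h1 : (-(m : ℝ)) ≤ x i := by exact_mod_cast hx1
  have h2 : (x i : ℝ) ≤ m := by exact_mod_cast hx2
  have h3 : (-(m : ℝ)) ≤ y i := by exact_mod_cast hy1
  have h4 : (y i : ℝ) ≤ m := by exact_mod_cast hy2
  have hzi : ((z i : ℝ) - ((x i : ℝ) + (y i : ℝ)) / 2) ^ 2 ≤ 48 * (m : ℝ) ^ 2 := by
    have hle : ((z i : ℝ) - ((x i : ℝ) + (y i : ℝ)) / 2) ^ 2 ≤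
        ∑ j, ((z j : ℝ) - ((x j : ℝ) + (y j : ℝ)) / 2) ^ 2 :=
      Finset.single_le_sum (f := fun j => ((z j : ℝ) - ((x j : ℝ) + (y j : ℝ)) / 2) ^ 2)
        (fun j _ => sq_nonneg _) (Finset.mem_univ i)
    linarith
  have hup : (z i : ℝ) - ((x i : ℝ) + (y i : ℝ)) / 2 ≤ 7 * m := by nlinarith
  have hlo : -(7 * (m : ℝ)) ≤ (z i : ℝ) - ((x i : ℝ) + (y i : ℝ)) / 2 := by nlinarith
  have hzle : (z i : ℝ) ≤ n := by linarith
  have hzge : (-(n : ℝ)) ≤ z i := by linarith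
  constructor
  · exact_mod_cast hzge
  · exact_mod_cast hzle

/-! ### Block long-range order of the inhomogeneous Villain current model on the space-time torus -/

/-- **Uniform equal-time block long-range order of the Villain current model with bondwise
stiffnesses (the engine, `ℝ≥0∞` form).**  There are `K₀ > 0` and `c > 0` such that for every
spatial side `M + 1`, every imaginary-time extent `T + 1` and EVERY bondwise stiffness field
`κ_b ≥ K₀` on the space-time torus `(ℤ/(M+1)ℤ)³ × ℤ/(T+1)ℤ` (`VillainCurrentModel`),
`c (M+1)⁶ Z(0) ≤ ∑_{x,y} Z(δ_{(x,0)} − δ_{(y,0)})`.  Chain: worm representation / duality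
(`VillainCurrentModel.twoPoint_eq_ofReal_villainTwoPoint`: `Z(ρ_{xy})/Z(0) = ⟨cos(θ_{(x,0)} − θ_{(y,0)})⟩_κ`,
the Villain spin two-point function of the torus multigraph) → Ginibre monotonicity down to the
constant stiffness `K₀` (`VillainCurrentModel.twoPoint_mono`) → pure Villain expectation on the
torus `U(1)^V` (`villainTwoPoint_eq_villainExpect`) → Garban–Spencer long-range order for the
Villain interaction on the torus bond system, with the ball-path ensemble of the cube
`{-⌊M/2⌋,…,⌊M/2⌋}³` pushed into the time-zero slice (`villain_longRangeOrder`, `sliceEmbedding`) →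
counting of the good pairs (`{-⌊M/16⌋,…,⌊M/16⌋}³`, `ball_subset_box`; the diagonal for `M < 15`),
`c = ½·16⁻⁶`.  No reflection positivity is used, whence no parity condition on `M + 1` and
uniformity in `T` and in the stiffness field. [folklore] -/
theorem villainCurrent_blockSum_lowerBound :
    ∃ K₀ c : ℝ, 0 < K₀ ∧ 0 < c ∧ ∀ (M T : ℕ) (P : VillainCurrentModel 3 (M + 1) (T + 1)),
      (∀ b, K₀ ≤ P.stiffness b) →
      ENNReal.ofReal c * ((M + 1 : ℝ≥0∞) ^ 6) * P.partitionFunction ≤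
        ∑ x : TorusSite 3 (M + 1), ∑ y : TorusSite 3 (M + 1),
          P.currentSum (wormSource x y : SpaceTimeSite 3 (M + 1) (T + 1) → ℤ) := by
  obtain ⟨Kc, a, hKc, ha, H⟩ := villain_longRangeOrder 3 le_rfl
  -- the stiffness threshold: `K₀ ≥ Kc`, `K₀ ≥ 1`, `K₀ ≥ 64 a²` (so that `√(a log K₀ / K₀) ≤ 1/2`)
  obtain ⟨K₀, hK₀c, hK₀1, hK₀a⟩ : ∃ K₀ : ℝ, Kc ≤ K₀ ∧ 1 ≤ K₀ ∧ 64 * a ^ 2 ≤ K₀ :=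
    ⟨max Kc (max 1 (64 * a ^ 2)), le_max_left _ _, le_trans (le_max_left _ _) (le_max_right _ _),
      le_trans (le_max_right _ _) (le_max_right _ _)⟩
  have hK₀0 : 0 < K₀ := lt_of_lt_of_le one_pos hK₀1
  have hhalf : (1 : ℝ) / 2 ≤ 1 - Real.sqrt (a * Real.log K₀ / K₀) := by
    have hlog : Real.log K₀ ≤ K₀ ^ (1 / 2 : ℝ) / (1 / 2) := Real.log_le_rpow_div hK₀0.le one_half_pos
    have hsq : K₀ ^ (1 / 2 : ℝ) = Real.sqrt K₀ := (Real.sqrt_eq_rpow K₀).symm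
    rw [hsq] at hlog
    have hs0 : 0 < Real.sqrt K₀ := Real.sqrt_pos.2 hK₀0
    have hs8 : 8 * a ≤ Real.sqrt K₀ := by
      rw [show 8 * a = Real.sqrt ((8 * a) ^ 2) by rw [Real.sqrt_sq (by positivity)]]
      exact Real.sqrt_le_sqrt (by nlinarith)
    have hK : a * Real.log K₀ / K₀ ≤ 1 / 4 := by
      rw [div_le_iff₀ hK₀0]
      have h1 : a * Real.log K₀ ≤ a * (2 * Real.sqrt K₀) :=
        mul_le_mul_of_nonneg_left (by linarith) ha.le
      have h2 : Real.sqrt K₀ * Real.sqrt K₀ = K₀ := Real.mul_self_sqrt hK₀0.le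
      nlinarith
    have : Real.sqrt (a * Real.log K₀ / K₀) ≤ 1 / 2 := by
      rw [show (1 / 2 : ℝ) = Real.sqrt (1 / 4) by
        rw [show (1 / 4 : ℝ) = (1 / 2) ^ 2 by norm_num, Real.sqrt_sq (by norm_num)]]
      exact Real.sqrt_le_sqrt hK
    linarith
  refine ⟨K₀, (1 / 2) * (1 / 16) ^ 6, hK₀0, by positivity, ?_⟩
  intro M T P hPK
  -- ### the real equal-time two-point function `G(x,y) = (Z(ρ_{xy})/Z(0)).toReal` and its block sum
  have hGnn : ∀ x y : TorusSite 3 (M + 1), 0 ≤ (P.twoPoint ((x, 0) : SpaceTimeSite 3 (M + 1) (T + 1)) ((y, 0) : SpaceTimeSite 3 (M + 1) (T + 1))).toReal := fun x y => ENNReal.toReal_nonneg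
  -- (i) the diagonal: `∑_{x,y} G ≥ ∑_x G(x,x) = (M+1)³`
  have hdiag : ((M : ℝ) + 1) ^ 3 ≤ ∑ x : TorusSite 3 (M + 1), ∑ y : TorusSite 3 (M + 1), (P.twoPoint ((x, 0) : SpaceTimeSite 3 (M + 1) (T + 1)) ((y, 0) : SpaceTimeSite 3 (M + 1) (T + 1))).toReal := by
    calc ((M : ℝ) + 1) ^ 3 = ∑ x : TorusSite 3 (M + 1), (P.twoPoint ((x, 0) : SpaceTimeSite 3 (M + 1) (T + 1)) ((x, 0) : SpaceTimeSite 3 (M + 1) (T + 1))).toReal := by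
          simp only [VillainCurrentModel.twoPoint_self, ENNReal.toReal_one, Finset.sum_const,
            Finset.card_univ, nsmul_eq_mul, mul_one]
          rw [Fintype.card_pi, Finset.prod_const, ZMod.card, Finset.card_univ, Fintype.card_fin]
          push_cast; ring
      _ ≤ _ := Finset.sum_le_sum fun x _ =>
          Finset.single_le_sum (f := fun y => (P.twoPoint ((x, 0) : SpaceTimeSite 3 (M + 1) (T + 1)) ((y, 0) : SpaceTimeSite 3 (M + 1) (T + 1))).toReal) (fun y _ => hGnn x y) (Finset.mem_univ x)
  -- (ii) the good pairs: the cube `{-m..m}³`, `m = ⌊M/16⌋`, inside the cube `{-n..n}³`, `n = ⌊M/2⌋`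
  obtain ⟨n, hn⟩ : ∃ n : ℕ, n = M / 2 := ⟨_, rfl⟩
  obtain ⟨m, hm⟩ : ∃ m : ℕ, m = M / 16 := ⟨_, rfl⟩
  have hmn : 8 * m ≤ n := by omega
  have h2n : 2 * n < M + 1 := by omega
  have hinj := torusProj_injOn_box_of_lt (d := 3) h2n
  have hbox : box 3 m ⊆ box 3 n := box_mono 3 (by omega)
  -- the comparison model with the constant stiffness `K₀`
  obtain ⟨P₀, hP₀⟩ : ∃ P₀ : VillainCurrentModel 3 (M + 1) (T + 1), ∀ b, P₀.stiffness b = K₀ :=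
    ⟨VillainCurrentModel.homogeneous (fun _ => K₀) (fun _ => hK₀0), fun _ => rfl⟩
  have hP₀s : P₀.stiffness = fun _ => K₀ := funext hP₀
  -- every good pair has `G ≥ 1/2`
  have hgood : ∀ x ∈ box 3 m, ∀ y ∈ box 3 m, (1 : ℝ) / 2 ≤ (P.twoPoint ((Torus.proj (M + 1) x, 0) : SpaceTimeSite 3 (M + 1) (T + 1)) ((Torus.proj (M + 1) y, 0) : SpaceTimeSite 3 (M + 1) (T + 1))).toReal := by
    intro x hx y hy
    have hxn : x ∈ box 3 n := hbox hx
    have hyn : y ∈ box 3 n := hbox hy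
    -- Ginibre monotonicity down to the constant stiffness `K₀` (current side)
    have h0 : P₀.twoPoint ((Torus.proj (M + 1) x, 0) : SpaceTimeSite 3 (M + 1) (T + 1))
        ((Torus.proj (M + 1) y, 0)) ≤
        P.twoPoint ((Torus.proj (M + 1) x, 0) : SpaceTimeSite 3 (M + 1) (T + 1)) ((Torus.proj (M + 1) y, 0)) :=
      P₀.twoPoint_mono P (fun b => (hP₀ b).le.trans (hPK b)) _ _
    -- duality: the comparison model's two-point function is the pure Villain expectation on the
    -- torus bond system at stiffness `K₀`
    have h1 := P₀.twoPoint_eq_ofReal_villainTwoPoint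
      ((Torus.proj (M + 1) x, 0) : SpaceTimeSite 3 (M + 1) (T + 1)) ((Torus.proj (M + 1) y, 0))
    have h2 : villainTwoPoint (Prod.fst : Bond 3 (M + 1) (T + 1) → SpaceTimeSite 3 (M + 1) (T + 1))
        (fun b => b.1 + unitVec b.2) (fun _ => K₀)
        ((Torus.proj (M + 1) x, 0) : SpaceTimeSite 3 (M + 1) (T + 1)) ((Torus.proj (M + 1) y, 0)) =
        (JCurrent.bondSystem 3 (M + 1) (T + 1)).villainExpect K₀ 1
          (cosDiff ((Torus.proj (M + 1) x, 0)) ((Torus.proj (M + 1) y, 0))) :=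
      (JCurrent.bondSystem 3 (M + 1) (T + 1)).villainTwoPoint_eq_villainExpect hK₀0 _ _
    rw [hP₀s, h2] at h1
    -- Garban–Spencer on the torus, with the ball paths of `box 3 n` pushed into the slice
    have h3 := H K₀ hK₀c (box 3 n) (SpaceTimeSite 3 (M + 1) (T + 1)) (Bond 3 (M + 1) (T + 1))
      (JCurrent.bondSystem 3 (M + 1) (T + 1)) (sliceEmbedding (T + 1) hinj) x y hxn hyn
      (ball_subset_box hmn hx hy)
    rw [sliceEmbedding_vmap, sliceEmbedding_vmap] at h3
    rw [← ENNReal.ofReal_le_iff_le_toReal (P.twoPoint_ne_top _ _)]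
    calc ENNReal.ofReal (1 / 2) ≤ ENNReal.ofReal ((JCurrent.bondSystem 3 (M + 1) (T + 1)).villainExpect K₀ 1
          (cosDiff ((Torus.proj (M + 1) x, 0)) ((Torus.proj (M + 1) y, 0)))) :=
          ENNReal.ofReal_le_ofReal (hhalf.trans h3)
      _ = _ := h1.symm
      _ ≤ _ := h0
  -- the sum over the images of the good pairs
  have hcount : ((1 : ℝ) / 2) * (2 * (m : ℝ) + 1) ^ 6 ≤
      ∑ x : TorusSite 3 (M + 1), ∑ y : TorusSite 3 (M + 1), (P.twoPoint ((x, 0) : SpaceTimeSite 3 (M + 1) (T + 1)) ((y, 0) : SpaceTimeSite 3 (M + 1) (T + 1))).toReal := by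
    classical
    have hfinj : Set.InjOn (fun p : Site 3 × Site 3 => (Torus.proj (M + 1) p.1, Torus.proj (M + 1) p.2))
        ((box 3 m ×ˢ box 3 m : Finset (Site 3 × Site 3)) : Set (Site 3 × Site 3)) := by
      rintro ⟨p1, p2⟩ hp ⟨q1, q2⟩ hq hpq
      rw [Finset.coe_product] at hp hq
      simp only [Prod.mk.injEq] at hpq
      exact Prod.ext (hinj (hbox hp.1) (hbox hq.1) hpq.1) (hinj (hbox hp.2) (hbox hq.2) hpq.2)
    calc ((1 : ℝ) / 2) * (2 * (m : ℝ) + 1) ^ 6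
        = ∑ _p ∈ (box 3 m ×ˢ box 3 m : Finset (Site 3 × Site 3)), (1 : ℝ) / 2 := by
          rw [Finset.sum_const, Finset.card_product, card_box, nsmul_eq_mul]
          push_cast; ring
      _ ≤ ∑ p ∈ (box 3 m ×ˢ box 3 m : Finset (Site 3 × Site 3)), (P.twoPoint ((Torus.proj (M + 1) p.1, 0) : SpaceTimeSite 3 (M + 1) (T + 1)) ((Torus.proj (M + 1) p.2, 0) : SpaceTimeSite 3 (M + 1) (T + 1))).toReal := by
          refine Finset.sum_le_sum fun p hp => ?_
          rw [Finset.mem_product] at hp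
          exact hgood p.1 hp.1 p.2 hp.2
      _ = ∑ q ∈ (box 3 m ×ˢ box 3 m : Finset (Site 3 × Site 3)).image
            (fun p : Site 3 × Site 3 => (Torus.proj (M + 1) p.1, Torus.proj (M + 1) p.2)), (P.twoPoint ((q.1, 0) : SpaceTimeSite 3 (M + 1) (T + 1)) ((q.2, 0) : SpaceTimeSite 3 (M + 1) (T + 1))).toReal :=
          (Finset.sum_image (f := fun q : TorusSite 3 (M + 1) × TorusSite 3 (M + 1) => (P.twoPoint ((q.1, 0) : SpaceTimeSite 3 (M + 1) (T + 1)) ((q.2, 0) : SpaceTimeSite 3 (M + 1) (T + 1))).toReal)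
            (g := fun p : Site 3 × Site 3 => (Torus.proj (M + 1) p.1, Torus.proj (M + 1) p.2)) hfinj).symm
      _ ≤ ∑ q ∈ (Finset.univ : Finset (TorusSite 3 (M + 1) × TorusSite 3 (M + 1))), (P.twoPoint ((q.1, 0) : SpaceTimeSite 3 (M + 1) (T + 1)) ((q.2, 0) : SpaceTimeSite 3 (M + 1) (T + 1))).toReal :=
          Finset.sum_le_sum_of_subset_of_nonneg (Finset.subset_univ _) fun q _ _ => hGnn q.1 q.2
      _ = ∑ x : TorusSite 3 (M + 1), ∑ y : TorusSite 3 (M + 1), (P.twoPoint ((x, 0) : SpaceTimeSite 3 (M + 1) (T + 1)) ((y, 0) : SpaceTimeSite 3 (M + 1) (T + 1))).toReal := by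
          rw [← Finset.univ_product_univ, Finset.sum_product]
  -- (iii) the two regimes: the real block-sum bound
  have hreal : (1 : ℝ) / 2 * (1 / 16) ^ 6 * ((M : ℝ) + 1) ^ 6 ≤
      ∑ x : TorusSite 3 (M + 1), ∑ y : TorusSite 3 (M + 1), (P.twoPoint ((x, 0) : SpaceTimeSite 3 (M + 1) (T + 1)) ((y, 0) : SpaceTimeSite 3 (M + 1) (T + 1))).toReal := by
    by_cases hM : 15 ≤ M
    · have hm16 : ((M : ℝ) + 1) / 16 ≤ 2 * (m : ℝ) + 1 := by
        have h16 : 16 * m + 15 ≥ M := by omega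
        have h16' : (16 : ℝ) * m + 15 ≥ M := by exact_mod_cast h16
        have hM' : (15 : ℝ) ≤ M := by exact_mod_cast hM
        linarith
      have h0 : (0 : ℝ) ≤ ((M : ℝ) + 1) / 16 := by positivity
      calc (1 : ℝ) / 2 * (1 / 16) ^ 6 * ((M : ℝ) + 1) ^ 6 = (1 / 2) * (((M : ℝ) + 1) / 16) ^ 6 := by ring
        _ ≤ (1 / 2) * (2 * (m : ℝ) + 1) ^ 6 := by gcongr
        _ ≤ _ := hcount
    · push Not at hM
      have hM' : (M : ℝ) + 1 ≤ 15 := by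
        have : M + 1 ≤ 15 := by omega
        exact_mod_cast this
      have h0 : (0 : ℝ) ≤ (M : ℝ) + 1 := by positivity
      calc (1 : ℝ) / 2 * (1 / 16) ^ 6 * ((M : ℝ) + 1) ^ 6
          = ((1 : ℝ) / 2 * (1 / 16) ^ 6 * ((M : ℝ) + 1) ^ 3) * ((M : ℝ) + 1) ^ 3 := by ring
        _ ≤ 1 * ((M : ℝ) + 1) ^ 3 := by
            refine mul_le_mul_of_nonneg_right ?_ (by positivity)
            have h3 : ((M : ℝ) + 1) ^ 3 ≤ 15 ^ 3 := by gcongr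
            nlinarith
        _ = ((M : ℝ) + 1) ^ 3 := one_mul _
        _ ≤ _ := hdiag
  -- ### back to the `ℝ≥0∞` current sums: `Z(ρ_{xy}) = ofReal G(x,y) · Z(0)`
  have hsum : ∑ x : TorusSite 3 (M + 1), ∑ y : TorusSite 3 (M + 1),
      P.currentSum (wormSource x y : SpaceTimeSite 3 (M + 1) (T + 1) → ℤ) =
      ENNReal.ofReal (∑ x : TorusSite 3 (M + 1), ∑ y : TorusSite 3 (M + 1), (P.twoPoint ((x, 0) : SpaceTimeSite 3 (M + 1) (T + 1)) ((y, 0) : SpaceTimeSite 3 (M + 1) (T + 1))).toReal) * P.partitionFunction := by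
    rw [ENNReal.ofReal_sum_of_nonneg (fun x _ => Finset.sum_nonneg fun y _ => hGnn x y), Finset.sum_mul]
    refine Finset.sum_congr rfl fun x _ => ?_
    rw [ENNReal.ofReal_sum_of_nonneg (fun y _ => hGnn x y), Finset.sum_mul]
    refine Finset.sum_congr rfl fun y _ => ?_
    rw [ENNReal.ofReal_toReal (P.twoPoint_ne_top _ _), VillainCurrentModel.twoPoint_equalTime,
      ENNReal.div_mul_cancel P.partitionFunction_ne_zero P.partitionFunction_ne_top]
  rw [hsum]
  have hkey : ENNReal.ofReal ((1 : ℝ) / 2 * (1 / 16) ^ 6) * ((M + 1 : ℝ≥0∞) ^ 6) ≤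
      ENNReal.ofReal (∑ x : TorusSite 3 (M + 1), ∑ y : TorusSite 3 (M + 1),
        (P.twoPoint ((x, 0) : SpaceTimeSite 3 (M + 1) (T + 1)) ((y, 0) : SpaceTimeSite 3 (M + 1) (T + 1))).toReal) := by
    rw [show ((M + 1 : ℝ≥0∞) ^ 6) = ENNReal.ofReal (((M : ℝ) + 1) ^ 6) by
      rw [ENNReal.ofReal_pow (by positivity), ENNReal.ofReal_add (Nat.cast_nonneg M) zero_le_one,
        ENNReal.ofReal_natCast, ENNReal.ofReal_one], ← ENNReal.ofReal_mul (by positivity)]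
    exact ENNReal.ofReal_le_ofReal hreal
  exact mul_le_mul' hkey le_rfl

/-! ### The route item -/

/-- **`HomogeneousVillainLRO` (item stmt-AtomisticToContinuum-11478 of route BECStoquasticCensoring,
MILESTONE 0 of the engine) holds.**  Equal-time block long-range order of the (3+1)-dimensional
Villain current model on `(ℤ/(M+1)ℤ)³ × ℤ/(T+1)ℤ` with direction stiffnesses `K_i ≥ K₀`, uniformly
in `M`, `T` and the anisotropy: `c (M+1)⁶ Z(0) ≤ ∑_{x,y} Z(δ_{(x,0)} − δ_{(y,0)})`.  The inline
`ℝ≥0∞` current sums of the item are literally the current sums of `VillainCurrentModel.ofCurried`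
(`currentSum_ofCurried`) for the constant-in-space stiffness field `κ_{(s,i)} = K_i`, so this is the
special case of `villainCurrent_blockSum_lowerBound`. [folklore] -/
theorem homogeneousVillainLRO_proof :
    Summit.AtomisticToContinuum.BoseEinsteinCondensation.Theses.BECStoquasticCensoring.HomogeneousVillainLRO := by
  obtain ⟨K₀, c, hK₀, hc, H⟩ := villainCurrent_blockSum_lowerBound
  refine ⟨K₀, c, hc, ?_⟩
  intro M T Kd hKd Z
  have hKpos : ∀ i, 0 < Kd i := fun i => lt_of_lt_of_le hK₀ (hKd i)
  -- the inline current sums are the current sums of the Villain current model `ofCurried (K_i)`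
  have hZ : ∀ q : SpaceTimeSite 3 (M + 1) (T + 1) → ℤ,
      Z q = (VillainCurrentModel.ofCurried (d := 3) (L := M + 1) (M := T + 1)
        (fun _ i => Kd i) (fun _ i => hKpos i)).currentSum q :=
    fun q => (VillainCurrentModel.currentSum_ofCurried (d := 3) (L := M + 1) (M := T + 1)
      (fun _ i => Kd i) (fun _ i => hKpos i) q).symm
  have hsrc : ∀ x y : TorusSite 3 (M + 1),
      (fun z : SpaceTimeSite 3 (M + 1) (T + 1) =>
        (if z = (x, 0) then (1 : ℤ) else 0) - (if z = (y, 0) then 1 else 0)) = wormSource x y :=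
    fun x y => VillainCurrentModel.inlineSource_eq_wormSource x y
  have h := H M T (VillainCurrentModel.ofCurried (d := 3) (L := M + 1) (M := T + 1)
    (fun _ i => Kd i) (fun _ i => hKpos i)) (fun b => hKd _)
  calc ENNReal.ofReal c * ((M + 1 : ℝ≥0∞) ^ 6) * Z 0
      = ENNReal.ofReal c * ((M + 1 : ℝ≥0∞) ^ 6) * (VillainCurrentModel.ofCurried (d := 3) (L := M + 1)
          (M := T + 1) (fun _ i => Kd i) (fun _ i => hKpos i)).partitionFunction := by
        rw [hZ 0]; rfl
    _ ≤ _ := h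
    _ = ∑ x : Fin 3 → ZMod (M + 1), ∑ y : Fin 3 → ZMod (M + 1),
          Z (fun z => (if z = (x, 0) then 1 else 0) - (if z = (y, 0) then 1 else 0)) := by
        refine Finset.sum_congr rfl fun x _ => Finset.sum_congr rfl fun y _ => ?_
        rw [hsrc x y, hZ]

end Summit.AtomisticToContinuum.BoseEinsteinCondensation.Theorems
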